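import Literature.NumberTheory.QuadraticFields.ReducedForms
import Mathlib.Analysis.PSeries
import Mathlib.NumberTheory.Harmonic.Bounds
import HarnessLib

/-!
# Lattice sums `∑ 1/Q(x, y)` over a reduced positive definite form

Topic `NumberTheory/QuadraticFields`, namespace
`Literature.NumberTheory.QuadraticFields.BinaryQuadraticForm` (continuing `ReducedForms.lean`:
`reducedForms D`, the reduced primitive positive definite forms `Q = (a, b, c)` of discriminant
`D < 0`).  Everything here is PROVED (theorems only; no definitions, no named facts).

Main result `sum_inv_eval_le_of_mem_reducedForms`: for `Q = (a, b, c) ∈ reducedForms D`, `N ≥ 1`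
and any finite set `T` of non-zero lattice points `v = (x, y)` with `Q(v) ≤ N`,

  `∑_{v ∈ T} 1 / Q(v) ≤ 4 / a + (12 log N + 112) / √|D|`.

This is the elementary geometry-of-numbers estimate behind the partial sums of the Dedekind zeta
function of an imaginary quadratic field class by class — for the class of the form `(a, b, c)`,
`∑_{N𝔞 ≤ N} 1/N𝔞 = ½ ∑_{0 < Q(v) ≤ N} 1/Q(v) = (π/√|D|) log N + O(1/a + …)` (Davenport,
*Multiplicative Number Theory*, Ch. 6, the lattice-point count `∑_{n ≤ N} r(n)`; Goldfeld–Schinzel,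
*On Siegel's zero*, Ann. Sc. Norm. Super. Pisa (4) 2 (1975), Lemma 3 and §3, where the term `1/a`
summed over the reduced forms produces `∑_{(a,b,c)} 1/a`; Granville–Stark, Invent. Math. 139
(2000), §3.2, eq. (11)–(12)) — in the crude explicit form (constants `4`, `12`, `112` instead of
`π²/3`, `2π`) that suffices for "no Siegel zero" deductions, where only the shape
`O(1/a) + O((log N)/√|D|)` matters.  Proof: `4a·Q(x, y) = (2ax + by)² + |D| y²`; the points with
`y = 0` give `∑_{x ≠ 0} 1/(a x²) ≤ 4/a`; for fixed `y ≠ 0`, `Q(x, y) = a((x − θ)² + μ²)` with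
`μ = √|D| |y| / (2a)` and `∑_{x ∈ ℤ} 1/((x − θ)² + μ²) ≤ 6/μ + 4/μ²`
(`sum_inv_sq_sub_add_sq_le`); finally `|y| ≤ 2√N` and `∑_{k ≤ M} 1/k ≤ 1 + log M` (Mathlib
`harmonic_le_one_add_log`), `3a² ≤ |D|` for a reduced form.

## References

* H. Davenport, *Multiplicative Number Theory*, 2nd ed., GTM 74 (1980), Ch. 6. [DavenportMNT1980]
* D. M. Goldfeld, A. Schinzel, *On Siegel's zero*, Ann. Scuola Norm. Sup. Pisa Cl. Sci. (4) 2
  (1975), 571–583, §§2–3.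
* A. Granville, H. M. Stark, *ABC implies no "Siegel zeros" for L-functions of characters with
  negative discriminant*, Invent. Math. 139 (2000), §3.2. [GranvilleStark2000]
-/

noncomputable section

open Finset Real

namespace Literature.NumberTheory.QuadraticFields.BinaryQuadraticForm

/-! ### One-dimensional sums -/

/-- `∑_{k ∈ S} 1/k² ≤ 2` for a finite set `S` of positive integers. [folklore] -/
theorem sum_inv_natCast_sq_le_two (S : Finset ℕ) (hS : 0 ∉ S) :
    ∑ k ∈ S, ((k : ℝ) ^ 2)⁻¹ ≤ 2 := by
  have hsub : S ⊆ Ioo 0 (S.sup id + 1) := fun k hk =>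
    mem_Ioo.2 ⟨Nat.pos_of_ne_zero fun h => hS (h ▸ hk), Nat.lt_succ_of_le (le_sup (f := id) hk)⟩
  calc ∑ k ∈ S, ((k : ℝ) ^ 2)⁻¹ ≤ ∑ k ∈ Ioo 0 (S.sup id + 1), ((k : ℝ) ^ 2)⁻¹ :=
        sum_le_sum_of_subset_of_nonneg hsub fun k _ _ => by positivity
    _ ≤ 2 / ((0 : ℕ) + 1) := by exact_mod_cast sum_Ioo_inv_sq_le (α := ℝ) 0 (S.sup id + 1)
    _ = 2 := by norm_num

/-- `∑_{j ∈ S} 1/(j² + μ²) ≤ 3/μ + 2/μ²` for a finite `S ⊆ ℕ` and `μ > 0`: the `j ≤ ⌈μ⌉` contribute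
at most `(⌈μ⌉ + 1)/μ²`, the others at most `∑_{j > ⌈μ⌉} 1/j² ≤ 2/(⌈μ⌉ + 1)`. [folklore] -/
theorem sum_inv_natCast_sq_add_sq_le (S : Finset ℕ) {μ : ℝ} (hμ : 0 < μ) :
    ∑ j ∈ S, ((j : ℝ) ^ 2 + μ ^ 2)⁻¹ ≤ 3 / μ + 2 / μ ^ 2 := by
  set m : ℕ := ⌈μ⌉₊ with hm
  have hμm : μ ≤ m := Nat.le_ceil μ
  have hm1 : (m : ℝ) ≤ μ + 1 := (Nat.ceil_lt_add_one hμ.le).le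
  rw [← sum_filter_add_sum_filter_not S (fun j => j ≤ m)]
  have h1 : ∑ j ∈ S.filter (fun j => j ≤ m), ((j : ℝ) ^ 2 + μ ^ 2)⁻¹ ≤ (m + 1) / μ ^ 2 := by
    calc ∑ j ∈ S.filter (fun j => j ≤ m), ((j : ℝ) ^ 2 + μ ^ 2)⁻¹
        ≤ ∑ _j ∈ S.filter (fun j => j ≤ m), (μ ^ 2)⁻¹ :=
          sum_le_sum fun j _ => by
            gcongr
            nlinarith [sq_nonneg (j : ℝ)]
      _ = (S.filter (fun j => j ≤ m)).card * (μ ^ 2)⁻¹ := by rw [sum_const, nsmul_eq_mul]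
      _ ≤ (m + 1) * (μ ^ 2)⁻¹ := by
          gcongr
          have : S.filter (fun j => j ≤ m) ⊆ range (m + 1) := fun j hj =>
            mem_range.2 (Nat.lt_succ_of_le (mem_filter.1 hj).2)
          exact_mod_cast (card_le_card this).trans (card_range _).le
      _ = (m + 1) / μ ^ 2 := by rw [div_eq_mul_inv]
  have h2 : ∑ j ∈ S.filter (fun j => ¬ j ≤ m), ((j : ℝ) ^ 2 + μ ^ 2)⁻¹ ≤ 2 / (m + 1) := by
    have hsub : S.filter (fun j => ¬ j ≤ m) ⊆ Ioo m (S.sup id + 1) := fun j hj => by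
      rw [mem_filter, not_le] at hj
      exact mem_Ioo.2 ⟨hj.2, Nat.lt_succ_of_le (le_sup (f := id) hj.1)⟩
    calc ∑ j ∈ S.filter (fun j => ¬ j ≤ m), ((j : ℝ) ^ 2 + μ ^ 2)⁻¹
        ≤ ∑ j ∈ Ioo m (S.sup id + 1), ((j : ℝ) ^ 2 + μ ^ 2)⁻¹ :=
          sum_le_sum_of_subset_of_nonneg hsub fun j _ _ => by positivity
      _ ≤ ∑ j ∈ Ioo m (S.sup id + 1), ((j : ℝ) ^ 2)⁻¹ :=
          sum_le_sum fun j hj => by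
            have hj0 : (0 : ℝ) < j := by exact_mod_cast (lt_of_le_of_lt (Nat.zero_le m) (mem_Ioo.1 hj).1)
            gcongr
            nlinarith
      _ ≤ 2 / ((m : ℕ) + 1) := by exact_mod_cast sum_Ioo_inv_sq_le (α := ℝ) m (S.sup id + 1)
  have h3 : (m + 1) / μ ^ 2 ≤ 1 / μ + 2 / μ ^ 2 := by
    rw [div_add_div _ _ hμ.ne' (pow_ne_zero 2 hμ.ne'), div_le_div_iff₀ (pow_pos hμ 2)
      (mul_pos hμ (pow_pos hμ 2))]
    nlinarith [pow_pos hμ 2, pow_pos hμ 3]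
  have h4 : (2 : ℝ) / (m + 1) ≤ 2 / μ := by
    gcongr
    linarith
  calc _ ≤ (m + 1) / μ ^ 2 + 2 / (m + 1) := add_le_add h1 h2
    _ ≤ (1 / μ + 2 / μ ^ 2) + 2 / μ := add_le_add h3 h4
    _ = 3 / μ + 2 / μ ^ 2 := by ring

/-- **`∑_{x ∈ X} 1/((x − θ)² + μ²) ≤ 6/μ + 4/μ²`** for every finite `X ⊆ ℤ`, real `θ` and `μ > 0`
(split at `⌊θ⌋`: on either side the `k`-th integer is at distance `≥ k` from `θ`). [folklore] -/
theorem sum_inv_sq_sub_add_sq_le (X : Finset ℤ) (θ : ℝ) {μ : ℝ} (hμ : 0 < μ) :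
    ∑ x ∈ X, (((x : ℝ) - θ) ^ 2 + μ ^ 2)⁻¹ ≤ 6 / μ + 4 / μ ^ 2 := by
  set n₀ : ℤ := ⌊θ⌋ with hn₀
  have hfl : (n₀ : ℝ) ≤ θ := Int.floor_le θ
  have hfl' : θ < n₀ + 1 := Int.lt_floor_add_one θ
  rw [← sum_filter_add_sum_filter_not X (fun x => n₀ < x)]
  -- right half
  have hR : ∑ x ∈ X.filter (fun x => n₀ < x), (((x : ℝ) - θ) ^ 2 + μ ^ 2)⁻¹ ≤ 3 / μ + 2 / μ ^ 2 := by
    set j : ℤ → ℕ := fun x => (x - n₀ - 1).toNat with hj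
    have hinj : Set.InjOn j (X.filter (fun x => n₀ < x) : Set ℤ) := by
      intro x hx x' hx' h
      simp only [coe_filter, Set.mem_setOf_eq] at hx hx'
      have h1 : ((x - n₀ - 1).toNat : ℤ) = x - n₀ - 1 := Int.toNat_of_nonneg (by omega)
      have h2 : ((x' - n₀ - 1).toNat : ℤ) = x' - n₀ - 1 := Int.toNat_of_nonneg (by omega)
      have h3 : ((x - n₀ - 1).toNat : ℤ) = ((x' - n₀ - 1).toNat : ℤ) := by
        simpa [hj] using congrArg (fun n : ℕ => (n : ℤ)) h
      omega
    calc ∑ x ∈ X.filter (fun x => n₀ < x), (((x : ℝ) - θ) ^ 2 + μ ^ 2)⁻¹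
        ≤ ∑ x ∈ X.filter (fun x => n₀ < x), (((j x : ℕ) : ℝ) ^ 2 + μ ^ 2)⁻¹ := by
          refine sum_le_sum fun x hx => ?_
          have hx' : n₀ < x := (mem_filter.1 hx).2
          have hjx : ((j x : ℕ) : ℝ) = (x : ℝ) - n₀ - 1 := by
            have h1 : ((x - n₀ - 1).toNat : ℤ) = x - n₀ - 1 := Int.toNat_of_nonneg (by omega)
            have : ((j x : ℕ) : ℝ) = ((x - n₀ - 1 : ℤ) : ℝ) := by
              rw [hj]; exact_mod_cast h1
            rw [this]; push_cast; ring
          have h0 : (0 : ℝ) ≤ (j x : ℕ) := Nat.cast_nonneg _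
          have hle : ((j x : ℕ) : ℝ) ≤ (x : ℝ) - θ := by rw [hjx]; linarith
          exact inv_anti₀ (by positivity) (by linarith [pow_le_pow_left₀ h0 hle 2])
      _ = ∑ k ∈ (X.filter (fun x => n₀ < x)).image j, ((k : ℝ) ^ 2 + μ ^ 2)⁻¹ :=
          (sum_image (f := fun k : ℕ => ((k : ℝ) ^ 2 + μ ^ 2)⁻¹) hinj).symm
      _ ≤ 3 / μ + 2 / μ ^ 2 := sum_inv_natCast_sq_add_sq_le _ hμ
  -- left half
  have hL : ∑ x ∈ X.filter (fun x => ¬ n₀ < x), (((x : ℝ) - θ) ^ 2 + μ ^ 2)⁻¹ ≤ 3 / μ + 2 / μ ^ 2 := by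
    set j : ℤ → ℕ := fun x => (n₀ - x).toNat with hj
    have hinj : Set.InjOn j (X.filter (fun x => ¬ n₀ < x) : Set ℤ) := by
      intro x hx x' hx' h
      simp only [coe_filter, Set.mem_setOf_eq, not_lt] at hx hx'
      have h1 : ((n₀ - x).toNat : ℤ) = n₀ - x := Int.toNat_of_nonneg (by omega)
      have h2 : ((n₀ - x').toNat : ℤ) = n₀ - x' := Int.toNat_of_nonneg (by omega)
      have h3 : ((n₀ - x).toNat : ℤ) = ((n₀ - x').toNat : ℤ) := by
        simpa [hj] using congrArg (fun n : ℕ => (n : ℤ)) h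
      omega
    calc ∑ x ∈ X.filter (fun x => ¬ n₀ < x), (((x : ℝ) - θ) ^ 2 + μ ^ 2)⁻¹
        ≤ ∑ x ∈ X.filter (fun x => ¬ n₀ < x), (((j x : ℕ) : ℝ) ^ 2 + μ ^ 2)⁻¹ := by
          refine sum_le_sum fun x hx => ?_
          have hx' : x ≤ n₀ := not_lt.1 (mem_filter.1 hx).2
          have hjx : ((j x : ℕ) : ℝ) = (n₀ : ℝ) - x := by
            have h1 : ((n₀ - x).toNat : ℤ) = n₀ - x := Int.toNat_of_nonneg (by omega)
            have : ((j x : ℕ) : ℝ) = ((n₀ - x : ℤ) : ℝ) := by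
              rw [hj]; exact_mod_cast h1
            rw [this]; push_cast; ring
          have h0 : (0 : ℝ) ≤ (j x : ℕ) := Nat.cast_nonneg _
          have hle : ((j x : ℕ) : ℝ) ≤ θ - (x : ℝ) := by rw [hjx]; linarith
          have hsq : ((j x : ℕ) : ℝ) ^ 2 ≤ ((x : ℝ) - θ) ^ 2 := by
            rw [show ((x : ℝ) - θ) ^ 2 = (θ - x) ^ 2 by ring]
            exact pow_le_pow_left₀ h0 hle 2
          exact inv_anti₀ (by positivity) (by linarith)
      _ = ∑ k ∈ (X.filter (fun x => ¬ n₀ < x)).image j, ((k : ℝ) ^ 2 + μ ^ 2)⁻¹ :=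
          (sum_image (f := fun k : ℕ => ((k : ℝ) ^ 2 + μ ^ 2)⁻¹) hinj).symm
      _ ≤ 3 / μ + 2 / μ ^ 2 := sum_inv_natCast_sq_add_sq_le _ hμ
  calc _ ≤ (3 / μ + 2 / μ ^ 2) + (3 / μ + 2 / μ ^ 2) := add_le_add hR hL
    _ = 6 / μ + 4 / μ ^ 2 := by ring

/-- **Folding a sum over non-zero integers of absolute value `≤ M` onto `1, …, M`**: for `G ≥ 0`,
`∑_{x ∈ X} G(|x|) ≤ 2 ∑_{k=1}^{M} G(k)`. [folklore] -/
theorem sum_natAbs_le_two_mul_sum_Icc (X : Finset ℤ) {M : ℕ} (hX : ∀ x ∈ X, x ≠ 0 ∧ x.natAbs ≤ M)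
    (G : ℕ → ℝ) (hG : ∀ k, 0 ≤ G k) :
    ∑ x ∈ X, G x.natAbs ≤ 2 * ∑ k ∈ Icc 1 M, G k := by
  rw [← sum_filter_add_sum_filter_not X (fun x => 0 < x), two_mul]
  have hpos : ∑ x ∈ X.filter (fun x => 0 < x), G x.natAbs ≤ ∑ k ∈ Icc 1 M, G k := by
    have hinj : Set.InjOn Int.natAbs (X.filter (fun x => 0 < x) : Set ℤ) := by
      intro x hx x' hx' h
      simp only [coe_filter, Set.mem_setOf_eq] at hx hx'
      rcases Int.natAbs_eq_natAbs_iff.1 h with h' | h' <;> omega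
    rw [← sum_image hinj]
    refine sum_le_sum_of_subset_of_nonneg (fun k hk => ?_) fun k _ _ => hG k
    obtain ⟨x, hx, rfl⟩ := mem_image.1 hk
    have hx' := hX x (mem_filter.1 hx).1
    exact mem_Icc.2 ⟨Int.natAbs_pos.2 hx'.1, hx'.2⟩
  have hneg : ∑ x ∈ X.filter (fun x => ¬ 0 < x), G x.natAbs ≤ ∑ k ∈ Icc 1 M, G k := by
    have hinj : Set.InjOn Int.natAbs (X.filter (fun x => ¬ 0 < x) : Set ℤ) := by
      intro x hx x' hx' h
      simp only [coe_filter, Set.mem_setOf_eq, not_lt] at hx hx'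
      rcases Int.natAbs_eq_natAbs_iff.1 h with h' | h' <;> omega
    rw [← sum_image hinj]
    refine sum_le_sum_of_subset_of_nonneg (fun k hk => ?_) fun k _ _ => hG k
    obtain ⟨x, hx, rfl⟩ := mem_image.1 hk
    have hx' := hX x (mem_filter.1 hx).1
    exact mem_Icc.2 ⟨Int.natAbs_pos.2 hx'.1, hx'.2⟩
  linarith

/-! ### Harmonic and logarithmic bookkeeping -/

/-- `1 + log ⌊√(4N)⌋ ≤ 2 + (log N)/2` for `N ≥ 1` (since `⌊√(4N)⌋ ≤ 2√N` and `log 2 ≤ 1`).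
[folklore] -/
theorem one_add_log_sqrt_four_mul_le {N : ℕ} (hN : 1 ≤ N) :
    1 + Real.log (Nat.sqrt (4 * N) : ℕ) ≤ 2 + Real.log N / 2 := by
  set M : ℕ := Nat.sqrt (4 * N) with hM
  have hM2 : 2 ≤ M := by
    rw [hM, show (2 : ℕ) = Nat.sqrt (2 * 2) from (Nat.sqrt_eq 2).symm]
    exact Nat.sqrt_le_sqrt (by omega)
  have hM0 : (0 : ℝ) < M := by exact_mod_cast (lt_of_lt_of_le (by norm_num) hM2)
  have hN0 : (0 : ℝ) < N := by exact_mod_cast hN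
  have hMsq : (M : ℝ) ^ 2 ≤ 4 * N := by exact_mod_cast Nat.sqrt_le' (4 * N)
  have hMle : (M : ℝ) ≤ Real.sqrt (4 * N) := by
    rw [← Real.sqrt_sq hM0.le]
    exact Real.sqrt_le_sqrt hMsq
  have hlog : Real.log M ≤ Real.log (Real.sqrt (4 * N)) := Real.log_le_log hM0 hMle
  have hlog2 : Real.log 2 ≤ 1 := by
    have := Real.log_le_sub_one_of_pos (show (0 : ℝ) < 2 by norm_num)
    linarith
  have hsqrt : Real.log (Real.sqrt (4 * N)) = (Real.log 2 + Real.log 2 + Real.log N) / 2 := by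
    rw [Real.log_sqrt (by positivity), show (4 : ℝ) * N = 2 * (2 * N) by ring,
      Real.log_mul (by norm_num) (by positivity), Real.log_mul (by norm_num) hN0.ne']
    ring
  linarith

/-! ### The lattice sum of a reduced form -/

/-- **Lattice sums over a reduced form.**  Let `Q = (a, b, c) ∈ reducedForms D` (`D < 0`),
`N ≥ 1`, and let `T` be a finite set of non-zero lattice points `v = (x, y)` with `Q(x, y) ≤ N`.
Then `∑_{v ∈ T} 1/Q(v) ≤ 4/a + (12 log N + 112)/√|D|`.  (The `y = 0` line gives
`∑ 1/(a x²) ≤ 4/a`; a line `y ≠ 0` gives `≤ 12/(√|D| |y|) + 16 a/(|D| y²)` by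
`Q(x, y) = a((x − θ)² + μ²)`, `μ = √|D||y|/(2a)`, and `sum_inv_sq_sub_add_sq_le`; then `|y| ≤ 2√N`,
`∑_{k ≤ M} 1/k ≤ 1 + log M`, `∑ 1/k² ≤ 2`, `a ≤ √|D|`.)  The main terms of the true asymptotics are
`(π²/3)/a` and `(2π/√|D|) log N` (Goldfeld–Schinzel 1975, §3; Granville–Stark 2000, §3.2 (11));
only the shape is used downstream. [cite: DavenportMNT1980, Ch. 6] -/
theorem sum_inv_eval_le_of_mem_reducedForms {D : ℤ} (hD : D < 0) {Q : ℤ × ℤ × ℤ}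
    (hQ : Q ∈ reducedForms D) {N : ℕ} (hN : 1 ≤ N) (T : Finset (ℤ × ℤ))
    (hT : ∀ v ∈ T, v ≠ 0 ∧ Q.1 * v.1 ^ 2 + Q.2.1 * v.1 * v.2 + Q.2.2 * v.2 ^ 2 ≤ N) :
    ∑ v ∈ T, (1 : ℝ) / (Q.1 * v.1 ^ 2 + Q.2.1 * v.1 * v.2 + Q.2.2 * v.2 ^ 2 : ℤ) ≤
      4 / Q.1 + (12 * Real.log N + 112) / Real.sqrt (-(D : ℝ)) := by
  obtain ⟨a, b, c⟩ := Q
  obtain ⟨hdisc, ha, -, hred⟩ := (mem_reducedForms_iff hD).1 hQ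
  obtain ⟨-, hb1, hb2, hac⟩ := le_of_isReduced hdisc ha hred
  rw [discr_apply] at hdisc
  simp only at ha hdisc hT ⊢
  -- basic quantities
  set q : ℝ := -(D : ℝ) with hq
  have hqD : q = 4 * a * c - (b : ℝ) ^ 2 := by
    rw [hq, ← hdisc]; push_cast; ring
  have h3a' : 3 * a ^ 2 ≤ 4 * a * c - b ^ 2 := by nlinarith
  have h3a : 3 * (a : ℝ) ^ 2 ≤ q := by rw [hqD]; exact_mod_cast h3a'
  have ha0 : (0 : ℝ) < a := by exact_mod_cast ha
  have ha1 : (1 : ℝ) ≤ a := by exact_mod_cast ha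
  have hq0 : 0 < q := by nlinarith
  have hsq0 : 0 < Real.sqrt q := Real.sqrt_pos.2 hq0
  have hsq2 : Real.sqrt q ^ 2 = q := Real.sq_sqrt hq0.le
  have hasq : (a : ℝ) ≤ Real.sqrt q := by
    rw [← Real.sqrt_sq ha0.le]
    exact Real.sqrt_le_sqrt (by nlinarith)
  -- the form
  set ev : ℤ × ℤ → ℤ := fun v => a * v.1 ^ 2 + b * v.1 * v.2 + c * v.2 ^ 2 with hev
  have hev' : ∀ v : ℤ × ℤ, (ev v : ℝ) = a * (v.1 : ℝ) ^ 2 + b * v.1 * v.2 + c * (v.2 : ℝ) ^ 2 := by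
    intro v; rw [hev]; push_cast; ring
  change ∑ v ∈ T, (1 : ℝ) / (ev v : ℝ) ≤ _
  -- `4a Q(v) = (2ax + by)² + q y²`
  have hkey : ∀ v : ℤ × ℤ,
      4 * (a : ℝ) * (ev v : ℝ) = (2 * a * v.1 + b * v.2 : ℝ) ^ 2 + q * (v.2 : ℝ) ^ 2 := by
    intro v; rw [hev', hqD]; ring
  -- split `T` according to `y = 0`
  rw [← sum_filter_add_sum_filter_not T (fun v => v.2 = 0)]
  /- 1. the line `y = 0`: `∑ 1/(a x²) ≤ 4/a` -/
  have hT0 : ∑ v ∈ T.filter (fun v => v.2 = 0), (1 : ℝ) / (ev v : ℝ) ≤ 4 / a := by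
    set T₀ := T.filter (fun v => v.2 = 0) with hT₀
    have hmem : ∀ v ∈ T₀, v.2 = 0 ∧ v.1 ≠ 0 := by
      intro v hv
      obtain ⟨hvT, hy⟩ := mem_filter.1 hv
      refine ⟨hy, fun hx => (hT v hvT).1 ?_⟩
      exact Prod.ext hx hy
    have h1 : ∀ v ∈ T₀, (1 : ℝ) / (ev v : ℝ) = (a : ℝ)⁻¹ * (((v.1.natAbs : ℕ) : ℝ) ^ 2)⁻¹ := by
      intro v hv
      obtain ⟨hy, hx⟩ := hmem v hv
      have habs : ((v.1.natAbs : ℕ) : ℝ) ^ 2 = (v.1 : ℝ) ^ 2 := by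
        rw [Nat.cast_natAbs, Int.cast_abs, sq_abs]
      rw [hev', hy, habs]
      push_cast
      rw [one_div, show (a : ℝ) * (v.1 : ℝ) ^ 2 + b * v.1 * 0 + c * (0 : ℝ) ^ 2 = a * (v.1 : ℝ) ^ 2 by ring,
        mul_inv]
    rw [sum_congr rfl h1, ← mul_sum]
    have hinj : Set.InjOn Prod.fst (T₀ : Set (ℤ × ℤ)) := by
      intro v hv w hw h
      exact Prod.ext h ((hmem v hv).1.trans (hmem w hw).1.symm)
    have h2 : ∑ v ∈ T₀, (((v.1.natAbs : ℕ) : ℝ) ^ 2)⁻¹ =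
        ∑ x ∈ T₀.image Prod.fst, (((x.natAbs : ℕ) : ℝ) ^ 2)⁻¹ :=
      (sum_image (f := fun x : ℤ => (((x.natAbs : ℕ) : ℝ) ^ 2)⁻¹) hinj).symm
    have h3 : ∑ x ∈ T₀.image Prod.fst, (((x.natAbs : ℕ) : ℝ) ^ 2)⁻¹ ≤
        2 * ∑ k ∈ Icc 1 ((T₀.image Prod.fst).sup Int.natAbs), (((k : ℕ) : ℝ) ^ 2)⁻¹ := by
      refine sum_natAbs_le_two_mul_sum_Icc _ (fun x hx => ?_) (fun k => (((k : ℕ) : ℝ) ^ 2)⁻¹)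
        fun k => by positivity
      obtain ⟨v, hv, rfl⟩ := mem_image.1 hx
      exact ⟨(hmem v hv).2, le_sup (f := Int.natAbs) hx⟩
    have h4 : ∑ k ∈ Icc 1 ((T₀.image Prod.fst).sup Int.natAbs), (((k : ℕ) : ℝ) ^ 2)⁻¹ ≤ 2 :=
      sum_inv_natCast_sq_le_two _ (by simp)
    rw [h2]
    calc (a : ℝ)⁻¹ * ∑ x ∈ T₀.image Prod.fst, (((x.natAbs : ℕ) : ℝ) ^ 2)⁻¹
        ≤ (a : ℝ)⁻¹ * (2 * 2) := by
          refine mul_le_mul_of_nonneg_left (h3.trans ?_) (inv_nonneg.2 ha0.le)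
          linarith
      _ = 4 / a := by rw [div_eq_mul_inv, mul_comm]; norm_num
  /- 2. the lines `y ≠ 0` -/
  have hT1 : ∑ v ∈ T.filter (fun v => ¬ v.2 = 0), (1 : ℝ) / (ev v : ℝ) ≤
      (12 * Real.log N + 112) / Real.sqrt q := by
    set T₁ := T.filter (fun v => ¬ v.2 = 0) with hT₁
    set M : ℕ := Nat.sqrt (4 * N) with hM
    -- `|y| ≤ M` on `T₁`
    have hyM : ∀ v ∈ T₁, v.2 ≠ 0 ∧ v.2.natAbs ≤ M := by
      intro v hv
      obtain ⟨hvT, hy⟩ := mem_filter.1 hv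
      refine ⟨hy, ?_⟩
      obtain ⟨-, hle⟩ := hT v hvT
      have hle' : (ev v : ℤ) ≤ N := hle
      -- `q y² ≤ 4 a Q(v) ≤ 4 a N` and `3a² ≤ q`, `a ≥ 1` give `y² ≤ 4N`
      have h1 : (4 * a * c - b ^ 2) * v.2 ^ 2 ≤ 4 * a * N := by
        have e : 4 * a * ev v = (2 * a * v.1 + b * v.2) ^ 2 + (4 * a * c - b ^ 2) * v.2 ^ 2 := by
          rw [hev]; ring
        nlinarith [sq_nonneg (2 * a * v.1 + b * v.2)]
      have h2 : v.2 ^ 2 ≤ 4 * (N : ℤ) := by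
        have e1 : 3 * a ^ 2 * v.2 ^ 2 ≤ 4 * a * N :=
          (mul_le_mul_of_nonneg_right h3a' (sq_nonneg _)).trans h1
        have e2 : a * (3 * a * v.2 ^ 2) ≤ a * (4 * N) := by linarith
        have e3 : 3 * a * v.2 ^ 2 ≤ 4 * N := le_of_mul_le_mul_left e2 ha
        nlinarith [sq_nonneg v.2]
      rw [hM, Nat.le_sqrt]
      have h3 : (v.2.natAbs : ℤ) * v.2.natAbs ≤ 4 * N := by
        rw [Int.natAbs_mul_self' ]; nlinarith
      exact_mod_cast h3
    -- fibre over `y`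
    have hfib : ∀ y ∈ T₁.image Prod.snd,
        ∑ v ∈ T₁.filter (fun v => v.2 = y), (1 : ℝ) / (ev v : ℝ) ≤
          12 / (Real.sqrt q * (y.natAbs : ℕ)) + 16 * a / (q * ((y.natAbs : ℕ) : ℝ) ^ 2) := by
      intro y hy
      obtain ⟨w, hw, rfl⟩ := mem_image.1 hy
      have hy0 : w.2 ≠ 0 := (hyM w hw).1
      set y := w.2 with hydef
      have hy0' : (y : ℝ) ≠ 0 := by exact_mod_cast hy0
      have hyabs : ((y.natAbs : ℕ) : ℝ) = |(y : ℝ)| := by rw [Nat.cast_natAbs, Int.cast_abs]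
      have hyabs0 : 0 < |(y : ℝ)| := abs_pos.2 hy0'
      set θ : ℝ := -(b * y) / (2 * a) with hθ
      set μ : ℝ := Real.sqrt q * |(y : ℝ)| / (2 * a) with hμ
      have hμ0 : 0 < μ := by rw [hμ]; positivity
      have hμ2 : μ ^ 2 = q * (y : ℝ) ^ 2 / (4 * a ^ 2) := by
        rw [hμ, div_pow, mul_pow, hsq2, sq_abs]; ring
      -- `Q(x, y) = a ((x − θ)² + μ²)`
      have hfac : ∀ v ∈ T₁.filter (fun v => v.2 = y),
          (1 : ℝ) / (ev v : ℝ) = (a : ℝ)⁻¹ * (((v.1 : ℝ) - θ) ^ 2 + μ ^ 2)⁻¹ := by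
        intro v hv
        have hvy : v.2 = y := (mem_filter.1 hv).2
        have e : (ev v : ℝ) = a * (((v.1 : ℝ) - θ) ^ 2 + μ ^ 2) := by
          rw [hev', hvy, hμ2, hθ, hqD]
          field_simp
          ring
        rw [e, one_div, mul_inv]
      rw [sum_congr rfl hfac, ← mul_sum]
      have hinj : Set.InjOn Prod.fst (T₁.filter (fun v => v.2 = y) : Set (ℤ × ℤ)) := by
        intro v hv v' hv' h
        rw [coe_filter] at hv hv'
        exact Prod.ext h (hv.2.trans hv'.2.symm)
      rw [← sum_image (f := fun x : ℤ => (((x : ℝ) - θ) ^ 2 + μ ^ 2)⁻¹) hinj]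
      have hone := sum_inv_sq_sub_add_sq_le ((T₁.filter (fun v => v.2 = y)).image Prod.fst) θ hμ0
      calc (a : ℝ)⁻¹ * ∑ x ∈ (T₁.filter (fun v => v.2 = y)).image Prod.fst, (((x : ℝ) - θ) ^ 2 + μ ^ 2)⁻¹
          ≤ (a : ℝ)⁻¹ * (6 / μ + 4 / μ ^ 2) := mul_le_mul_of_nonneg_left hone (inv_nonneg.2 ha0.le)
        _ = 12 / (Real.sqrt q * (y.natAbs : ℕ)) + 16 * a / (q * ((y.natAbs : ℕ) : ℝ) ^ 2) := by
          rw [hyabs, hμ2, hμ, sq_abs]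
          field_simp
          ring
    -- sum over the fibres
    have hmaps : ∀ v ∈ T₁, v.2 ∈ T₁.image Prod.snd := fun v hv => mem_image_of_mem _ hv
    rw [← sum_fiberwise_of_maps_to hmaps]
    set F : ℕ → ℝ := fun k => 12 / (Real.sqrt q * k) + 16 * a / (q * (k : ℝ) ^ 2) with hF
    have hF0 : ∀ k, 0 ≤ F k := fun k => by rw [hF]; positivity
    have hstep1 : ∑ y ∈ T₁.image Prod.snd, ∑ v ∈ T₁.filter (fun v => v.2 = y), (1 : ℝ) / (ev v : ℝ) ≤
        ∑ y ∈ T₁.image Prod.snd, F y.natAbs := sum_le_sum fun y hy => hfib y hy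
    have hstep2 : ∑ y ∈ T₁.image Prod.snd, F y.natAbs ≤ 2 * ∑ k ∈ Icc 1 M, F k := by
      refine sum_natAbs_le_two_mul_sum_Icc _ (fun y hy => ?_) F hF0
      obtain ⟨v, hv, rfl⟩ := mem_image.1 hy
      exact hyM v hv
    -- evaluate `2 ∑_{k ≤ M} F k`
    have hharm : ∑ k ∈ Icc 1 M, ((k : ℝ))⁻¹ ≤ 2 + Real.log N / 2 := by
      -- `∑_{k ≤ M} 1/k ≤ 1 + log M` (Mathlib `harmonic_le_one_add_log`; the `ℝ`-cast form is also
      -- `Literature.NumberTheory.Sieve.harmonic_Icc_le`, not imported here)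
      have h := harmonic_le_one_add_log M
      rw [harmonic_eq_sum_Icc] at h
      push_cast at h
      exact h.trans (one_add_log_sqrt_four_mul_le hN)
    have hsq' : ∑ k ∈ Icc 1 M, (((k : ℕ) : ℝ) ^ 2)⁻¹ ≤ 2 := sum_inv_natCast_sq_le_two _ (by simp)
    have hsumF : ∑ k ∈ Icc 1 M, F k =
        12 / Real.sqrt q * ∑ k ∈ Icc 1 M, ((k : ℝ))⁻¹ + 16 * a / q * ∑ k ∈ Icc 1 M, (((k : ℕ) : ℝ) ^ 2)⁻¹ := by
      rw [hF, sum_add_distrib, mul_sum, mul_sum]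
      refine congrArg₂ (· + ·) (sum_congr rfl fun k _ => ?_) (sum_congr rfl fun k _ => ?_)
      · rw [div_mul_eq_div_mul_one_div, one_div]
      · rw [div_mul_eq_div_mul_one_div, one_div]
    have hlogN : 0 ≤ Real.log N := Real.log_natCast_nonneg N
    have haq : 16 * (a : ℝ) / q ≤ 16 / Real.sqrt q := by
      rw [div_le_div_iff₀ hq0 hsq0]
      have : (a : ℝ) * Real.sqrt q ≤ Real.sqrt q * Real.sqrt q := by gcongr
      nlinarith [hsq2]
    have hbound : 2 * ∑ k ∈ Icc 1 M, F k ≤ (12 * Real.log N + 112) / Real.sqrt q := by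
      rw [hsumF]
      have e1 : 12 / Real.sqrt q * ∑ k ∈ Icc 1 M, ((k : ℝ))⁻¹ ≤ 12 / Real.sqrt q * (2 + Real.log N / 2) :=
        mul_le_mul_of_nonneg_left hharm (by positivity)
      have e2 : 16 * (a : ℝ) / q * ∑ k ∈ Icc 1 M, (((k : ℕ) : ℝ) ^ 2)⁻¹ ≤ 16 / Real.sqrt q * 2 :=
        mul_le_mul haq hsq' (sum_nonneg fun k _ => by positivity) (by positivity)
      have e3 : 2 * (12 / Real.sqrt q * (2 + Real.log N / 2) + 16 / Real.sqrt q * 2) =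
          (12 * Real.log N + 112) / Real.sqrt q := by
        field_simp
        ring
      linarith
    linarith
  have hfin : 4 / (a : ℝ) + (12 * Real.log N + 112) / Real.sqrt q =
      4 / (a : ℝ) + (12 * Real.log N + 112) / Real.sqrt (-(D : ℝ)) := by rw [hq]
  linarith

end Literature.NumberTheory.QuadraticFields.BinaryQuadraticForm

end
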